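import Summits.Schanuel.Schanuel.Theorems.DiophantineDichotomyApproximationPropertyCycleAPIAt3Defs
import Summits.Schanuel.Schanuel.Theorems.DiophantineDichotomyApproximationPropertyHilbertTruncation
import Literature.NumberTheory.Transcendental.RoySmallValueFactors
import Literature.RingTheory.MvPolynomial.HomogeneousHilbertFunction
import HarnessLib

/-!
# Lemmas for the stub `highSatellite3_of` of line `orbit-interpolation-determinant` (crux `ApproximationProperty`, stmt-Schanuel-6117)

Route `DiophantineDichotomy` (sub-problem `Schanuel/Schanuel`), crux
`Summit.Schanuel.Schanuel.Theses.DiophantineDichotomy.ApproximationProperty` (stmt-Schanuel-6117), line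
`orbit-interpolation-determinant`, skeleton v24 (lead `prover-line-stmt-Schanuel-6117-c12-0`). Helper lemmas of the
HIGH-SATELLITE lever (assembled in `…HighSatelliteOf.lean`, registered stub `highSatellite3_of`):

* algebra — `mem_of_envelope` (envelope transport: a form of `𝔭` of degree `≤ ν` lies in the enveloping prime `𝔮'`,
  via a power of a variable outside `𝔮'`), `hilbert_count` (standard monomials of degree `b₂` modulo a form of degree
  `a₂`: at least `a₂·binom(b₂−a₂+3, 2)`, from the landed `hilbert_span_singleton_eq`);
* arithmetic — `liouville_exponent_lt` (the exponent of Nesterenko's Prop. 4.11 is beaten by the orbit's smallness),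
  `smallness_le`, `rateA`, `rateB` (bookkeeping of the two box principles).

Proofs only, no definitions. Sources: Nesterenko, LNM 1752 (2001) Ch. 3 §4 Prop. 4.11 (pp. 40–41).
-/

set_option linter.dupNamespace false

noncomputable section

namespace Summit.Schanuel.Schanuel.Cruxes.ApproximationProperty.OrbitInterpolationDeterminant

open Literature.NumberTheory.Transcendental Literature.NumberTheory.Transcendental.Nesterenko MvPolynomial Real
open scoped BigOperators Nat

/-! ## Algebra: envelope transport, Hilbert count of a principal ideal -/

/-- **Registered sub-goal `envelope_transport`** (crux `stmt-Schanuel-6117`, line `orbit-interpolation-determinant`,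
skeleton v24): if the forms of degree `ν` of `𝔭` lie in the prime `𝔮'` (the ENVELOPE `ℚ[x̲]_ν ∩ 𝔭 ⊆ 𝔮'`), a variable
misses `𝔮'`, and `g ∈ 𝔭` is a form of degree `μ ≤ ν`, then `g ∈ 𝔮'` (multiply by `xᵢ^{ν−μ}` and use primality).
[folklore] -/
theorem envelope_transport : ∀ {𝔭 𝔮' : Ideal (Rx 3)} {ν μ : ℕ} {g : Rx 3} {i : Fin (3 + 1)}, 𝔮'.IsPrime → (X i : Rx 3) ∉ 𝔮' → homogeneousSubmodule (Fin (3 + 1)) ℚ ν ⊓ 𝔭.restrictScalars ℚ ≤ 𝔮'.restrictScalars ℚ → g.IsHomogeneous μ → μ ≤ ν → g ∈ 𝔭 → g ∈ 𝔮' := by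
  intro 𝔭 𝔮' ν μ g i h𝔮' hi henv hg hμ hg𝔭
  set f : Rx 3 := X i ^ (ν - μ) * g with hfdef
  have hfhom : f.IsHomogeneous ν := by
    have h1 : ((X i : Rx 3) ^ (ν - μ)).IsHomogeneous (1 * (ν - μ)) := (isHomogeneous_X ℚ i).pow _
    have h2 := h1.mul hg
    rwa [show 1 * (ν - μ) + μ = ν by omega] at h2
  have hf𝔭 : f ∈ 𝔭 := 𝔭.mul_mem_left _ hg𝔭
  have hf𝔮' : f ∈ 𝔮' := by
    have : f ∈ homogeneousSubmodule (Fin (3 + 1)) ℚ ν ⊓ 𝔭.restrictScalars ℚ :=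
      ⟨(mem_homogeneousSubmodule ν f).mpr hfhom, hf𝔭⟩
    exact henv this
  rcases h𝔮'.mem_or_mem hf𝔮' with h | h
  · exact absurd (h𝔮'.mem_of_pow_mem _ h) hi
  · exact h

namespace HighSatellite

/-- **Envelope transport** (curried alias of the registered sub-goal `envelope_transport`). [folklore] -/
theorem mem_of_envelope {𝔭 𝔮' : Ideal (Rx 3)} {ν μ : ℕ} {g : Rx 3} {i : Fin (3 + 1)}
    (h𝔮' : 𝔮'.IsPrime) (hi : (X i : Rx 3) ∉ 𝔮')
    (henv : homogeneousSubmodule (Fin (3 + 1)) ℚ ν ⊓ 𝔭.restrictScalars ℚ ≤ 𝔮'.restrictScalars ℚ)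
    (hg : g.IsHomogeneous μ) (hμ : μ ≤ ν) (hg𝔭 : g ∈ 𝔭) : g ∈ 𝔮' :=
  envelope_transport h𝔮' hi henv hg hμ hg𝔭

/-- `binom(t+3, 3) + a·binom(t+3, 2) ≤ binom(t+a+3, 3)` (Pascal, and `binom(·, 2)` is monotone). [folklore] -/
theorem choose_add_mul_choose_le (t a : ℕ) :
    (t + 3).choose 3 + a * (t + 3).choose 2 ≤ (t + a + 3).choose 3 := by
  induction a with
  | zero => simp
  | succ n ih =>
    have h1 : (t + (n + 1) + 3).choose 3 = (t + n + 3).choose 3 + (t + n + 3).choose 2 := by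
      rw [show t + (n + 1) + 3 = (t + n + 3) + 1 by ring, Nat.choose_succ_succ', add_comm]
    have h2 : (t + 3).choose 2 ≤ (t + n + 3).choose 2 := Nat.choose_le_choose 2 (by omega)
    rw [h1, Nat.succ_mul]
    omega

/-- `d² ≤ 2·binom(t+3, 2)` for `d ≤ t` (`2·binom(t+3,2) = (t+3)(t+2)`). [folklore] -/
theorem sq_le_two_mul_choose {d t : ℕ} (h : d ≤ t) : d ^ 2 ≤ 2 * (t + 3).choose 2 := by
  have h1 : 2 * (t + 3).choose 2 = (t + 3) * (t + 2) := by
    have := Nat.choose_two_right (t + 3)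
    rw [this, show t + 3 - 1 = t + 2 by omega]
    have heven : 2 ∣ (t + 3) * (t + 2) := by
      rcases Nat.even_or_odd t with ⟨k, hk⟩ | ⟨k, hk⟩
      · exact ⟨(t + 3) * (k + 1), by subst hk; ring⟩
      · exact ⟨(k + 2) * (t + 2), by subst hk; ring⟩
    exact Nat.mul_div_cancel' heven
  rw [h1]
  nlinarith

/-- **Standard monomials modulo a form.** For a non-zero form `Q₂` of degree `a₂ ≤ b₂` in `ℚ[x₀, …, x₃]`, with
`t = b₂ − a₂`: `dim (Q₂)_{b₂} + a₂·binom(t+3, 2) ≤ dim ℚ[x̲]_{b₂}` (from the landed two values of the Hilbert function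
of a principal ideal, `hilbert_span_singleton_eq`). [folklore] -/
theorem hilbert_count {Q₂ : Rx 3} {a₂ b₂ : ℕ} (hQ₂ : Q₂.IsHomogeneous a₂) (hQ₂0 : Q₂ ≠ 0) (hab : a₂ ≤ b₂) :
    Module.finrank ℚ ↥(homogeneousSubmodule (Fin (3 + 1)) ℚ b₂ ⊓ (Ideal.span {Q₂}).restrictScalars ℚ) +
        a₂ * (b₂ - a₂ + 3).choose 2 ≤
      Module.finrank ℚ ↥(homogeneousSubmodule (Fin (3 + 1)) ℚ b₂) := by
  set t := b₂ - a₂ with ht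
  have hb : b₂ = t + a₂ := by omega
  obtain ⟨-, h2⟩ := HilbertTruncation.hilbert_span_singleton_eq 3 hQ₂ hQ₂0
  have h := h2 t
  have hS : Module.finrank ℚ ↥(homogeneousSubmodule (Fin (3 + 1)) ℚ (t + a₂)) = (t + a₂ + 3).choose (t + a₂) := by
    rw [Literature.RingTheory.HilbertSamuel.finrank_homogeneousSubmodule_fin,
      show t + a₂ + (3 + 1) - 1 = t + a₂ + 3 by omega]
  have hId : Literature.RingTheory.MvPolynomial.idealDegree (Ideal.span {Q₂}) (t + a₂) =
      homogeneousSubmodule (Fin (3 + 1)) ℚ (t + a₂) ⊓ (Ideal.span {Q₂}).restrictScalars ℚ := by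
    rw [Literature.RingTheory.MvPolynomial.idealDegree, inf_comm]
  have hBle : Module.finrank ℚ ↥(Literature.RingTheory.MvPolynomial.idealDegree (Ideal.span {Q₂}) (t + a₂)) ≤
      Module.finrank ℚ ↥(homogeneousSubmodule (Fin (3 + 1)) ℚ (t + a₂)) := by
    haveI := Literature.RingTheory.MvPolynomial.finite_homogeneousSubmodule (K := ℚ) (σ := Fin (3 + 1)) (t + a₂)
    rw [hId]; exact Submodule.finrank_mono inf_le_left
  have hsym1 : (t + a₂ + 3).choose (t + a₂) = (t + a₂ + 3).choose 3 := by
    rw [show t + a₂ + 3 = 3 + (t + a₂) by ring, Nat.choose_symm_add]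
  have hsym2 : (t + 3).choose t = (t + 3).choose 3 := by
    rw [show t + 3 = 3 + t by ring, Nat.choose_symm_add]
  have hL := choose_add_mul_choose_le t a₂
  rw [hb, ← hId]
  rw [hS] at h ⊢
  rw [hsym1] at h ⊢
  rw [hsym2] at h
  omega

/-! ## Arithmetic -/

/-- **The Liouville exponent is beaten by the orbit's smallness**: with `deg g ≤ Δ/(32c₁)`, `h(g) ≤ Y/c₁`, `Y ≥ Δ > 0`,
`D ≥ 1`, `h ≥ 0`: `h(g)D + h·deg g + 99 D deg g − (Δh + 8YD)/c₁ < 0`. [folklore] -/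
theorem liouville_exponent_lt {c₁ Δ Y D h hg dg : ℝ} (hc₁ : 1 ≤ c₁) (hΔ : 0 < Δ) (hΔY : Δ ≤ Y) (hD : 1 ≤ D)
    (hh : 0 ≤ h) (hdg : dg ≤ Δ / (32 * c₁)) (hhg : hg ≤ Y / c₁) :
    -((Δ * h + 8 * Y * D) / c₁) + (hg * D + h * dg + 11 * (3 : ℝ) ^ 2 * D * dg) < 0 := by
  have hc₁0 : 0 < c₁ := by linarith
  have e1 : hg * D ≤ Y / c₁ * D := mul_le_mul_of_nonneg_right hhg (by linarith)
  have e2 : h * dg ≤ h * (Δ / (32 * c₁)) := mul_le_mul_of_nonneg_left hdg hh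
  have e3 : 11 * (3 : ℝ) ^ 2 * D * dg ≤ 11 * (3 : ℝ) ^ 2 * D * (Δ / (32 * c₁)) :=
    mul_le_mul_of_nonneg_left hdg (by positivity)
  have e4 : 11 * (3 : ℝ) ^ 2 * D * (Δ / (32 * c₁)) ≤ 4 * Y * D / c₁ := by
    rw [show 11 * (3 : ℝ) ^ 2 * D * (Δ / (32 * c₁)) = (99 / 32) * (Δ * D) / c₁ by ring]
    rw [div_le_div_iff_of_pos_right hc₁0]
    nlinarith [mul_le_mul_of_nonneg_right hΔY (by linarith : (0 : ℝ) ≤ D)]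
  have e5 : h * (Δ / (32 * c₁)) ≤ Δ * h / c₁ := by
    rw [show h * (Δ / (32 * c₁)) = (Δ * h / c₁) * (1 / 32) by ring]
    have : 0 ≤ Δ * h / c₁ := by positivity
    nlinarith
  have e6 : 0 < Y * D / c₁ := by
    have : 0 < Y := by linarith
    positivity
  have key : hg * D + h * dg + 11 * (3 : ℝ) ^ 2 * D * dg ≤ Y / c₁ * D + Δ * h / c₁ + 4 * Y * D / c₁ := by
    linarith
  have : Y / c₁ * D + Δ * h / c₁ + 4 * Y * D / c₁ < (Δ * h + 8 * Y * D) / c₁ := by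
    rw [show (Δ * h + 8 * Y * D) / c₁ = Δ * h / c₁ + 8 * (Y * D / c₁) by ring,
      show Y / c₁ * D = Y * D / c₁ by ring, show 4 * Y * D / c₁ = 4 * (Y * D / c₁) by ring]
    linarith
  linarith

/-- **Smallness bookkeeping**: with `M₀ = 2c₁(8c₁ + c₁³)/r₀`, `Δ ≥ (8 + 6c₁c_B)/r₀ + 1`, `Y ≥ Δ`, `L ≥ Y/c₁` and
`X ≤ (8c₁ + c₁³)YΔ³`: `c_B(2κΔ + 1) − (r₀Δ³ − 2)L ≤ −X/(2M₀)`. [folklore] -/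
theorem smallness_le {r₀ cB κ c₁ Δ Y L X : ℝ} (hr₀ : 0 < r₀) (hcB : 0 < cB) (hκ1 : κ ≤ 1)
    (hc₁ : 1 ≤ c₁) (hΔ : (8 + 6 * c₁ * cB) / r₀ + 1 ≤ Δ) (hΔY : Δ ≤ Y) (hL : Y / c₁ ≤ L)
    (hX : X ≤ (8 * c₁ + c₁ ^ 3) * Y * Δ ^ 3) :
    cB * (2 * κ * Δ + 1) - (r₀ * Δ ^ 3 - 2) * L ≤ -(X / (2 * (2 * c₁ * (8 * c₁ + c₁ ^ 3) / r₀))) := by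
  have hc₁0 : 0 < c₁ := by linarith
  have hΔ1 : 1 ≤ Δ := le_trans (by rw [le_add_iff_nonneg_left]; positivity) hΔ
  have hΔ0 : 0 < Δ := by linarith
  have hY0 : 0 < Y := by linarith
  have hA : 0 < 8 * c₁ + c₁ ^ 3 := by positivity
  -- `r₀ Δ ≥ 8 + 6 c₁ cB`, hence `r₀ Δ³ ≥ 8 + 6 c₁ cB`
  have h1 : 8 + 6 * c₁ * cB ≤ r₀ * Δ := by
    have : (8 + 6 * c₁ * cB) / r₀ ≤ Δ := by linarith
    rw [div_le_iff₀ hr₀] at this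
    linarith [mul_comm Δ r₀]
  have hΔ3 : Δ ≤ Δ ^ 3 := by nlinarith [one_le_pow₀ (n := 2) hΔ1]
  have h2 : 8 + 6 * c₁ * cB ≤ r₀ * Δ ^ 3 := h1.trans (mul_le_mul_of_nonneg_left hΔ3 hr₀.le)
  have h3 : 0 ≤ r₀ * Δ ^ 3 - 2 := by nlinarith [show 0 ≤ 6 * c₁ * cB by positivity]
  -- the target, simplified
  have hM : X / (2 * (2 * c₁ * (8 * c₁ + c₁ ^ 3) / r₀)) ≤ r₀ * Δ ^ 3 * Y / (4 * c₁) := by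
    rw [div_le_div_iff₀ (by positivity) (by positivity)]
    have : X * (4 * c₁) ≤ (8 * c₁ + c₁ ^ 3) * Y * Δ ^ 3 * (4 * c₁) :=
      mul_le_mul_of_nonneg_right hX (by positivity)
    have e : r₀ * Δ ^ 3 * Y * (2 * (2 * c₁ * (8 * c₁ + c₁ ^ 3) / r₀)) =
        (8 * c₁ + c₁ ^ 3) * Y * Δ ^ 3 * (4 * c₁) := by
      field_simp
      ring
    rw [e]
    exact this
  have hLt : (r₀ * Δ ^ 3 - 2) * (Y / c₁) ≤ (r₀ * Δ ^ 3 - 2) * L := mul_le_mul_of_nonneg_left hL h3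
  -- `cB (2κΔ+1) + 2Y/c₁ + r₀Δ³Y/(4c₁) ≤ r₀ Δ³ Y/c₁`
  have hκΔ : cB * (2 * κ * Δ + 1) ≤ 3 * cB * Δ := by nlinarith [mul_le_mul_of_nonneg_right hκ1 hΔ0.le]
  have h4 : 3 * cB * Δ ≤ r₀ * Δ ^ 3 * Y / (2 * c₁) := by
    rw [le_div_iff₀ (by positivity)]
    have e1 : 3 * cB * Δ * (2 * c₁) = (6 * c₁ * cB) * Δ := by ring
    rw [e1]
    have e2 : (6 * c₁ * cB) * Δ ≤ (r₀ * Δ ^ 3) * Δ := mul_le_mul_of_nonneg_right (by linarith) hΔ0.le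
    have e3 : (r₀ * Δ ^ 3) * Δ ≤ r₀ * Δ ^ 3 * Y := mul_le_mul_of_nonneg_left hΔY (by positivity)
    linarith
  have h5 : 2 * (Y / c₁) ≤ r₀ * Δ ^ 3 * Y / (4 * c₁) := by
    rw [show 2 * (Y / c₁) = 8 * Y / (4 * c₁) by field_simp; ring, div_le_div_iff_of_pos_right (by positivity)]
    have h8 : 8 ≤ r₀ * Δ ^ 3 := by nlinarith [show 0 ≤ 6 * c₁ * cB by positivity]
    nlinarith [mul_le_mul_of_nonneg_right h8 hY0.le]
  have hsplit : r₀ * Δ ^ 3 * Y / (4 * c₁) + r₀ * Δ ^ 3 * Y / (2 * c₁) + r₀ * Δ ^ 3 * Y / (4 * c₁) =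
      (r₀ * Δ ^ 3) * (Y / c₁) := by
    field_simp
    ring
  nlinarith

/-- **Rate, case A**: `((C − 4)/2) ≥ r₀Δ³ − 2` when `6C ≥ (d₁+1)³`, `d₁ ≥ κΔ/2`, `κ, Δ ≥ 0`, `r₀ ≤ κ³/96`.
[folklore] -/
theorem rateA {C d₁ κ Δ r₀ : ℝ} (hC : (d₁ + 1) ^ 3 ≤ 6 * C) (hd₁ : κ * Δ / 2 ≤ d₁) (hκ : 0 ≤ κ) (hΔ : 0 ≤ Δ)
    (hr₀ : r₀ ≤ κ ^ 3 / 96) : r₀ * Δ ^ 3 - 2 ≤ (C - 4) / 2 := by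
  have hd₁0 : 0 ≤ d₁ := le_trans (by positivity) hd₁
  have h1 : (κ * Δ / 2) ^ 3 ≤ d₁ ^ 3 := pow_le_pow_left₀ (by positivity) hd₁ 3
  have h2 : d₁ ^ 3 ≤ (d₁ + 1) ^ 3 := pow_le_pow_left₀ hd₁0 (by linarith) 3
  have h3 : (κ * Δ / 2) ^ 3 = κ ^ 3 * Δ ^ 3 / 8 := by ring
  have h4 : r₀ * Δ ^ 3 ≤ κ ^ 3 / 96 * Δ ^ 3 := mul_le_mul_of_nonneg_right hr₀ (by positivity)
  nlinarith

/-- **Rate, case B**: `((M₂ − 4)/2) ≥ r₀Δ³ − 2` when `2M₂ ≥ a₂d₁²`, `a₂ ≥ ηΔ/2`, `d₁ ≥ κΔ/2`, `η, κ, Δ ≥ 0`,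
`r₀ ≤ ηκ²/32`. [folklore] -/
theorem rateB {M₂ a₂ d₁ η κ Δ r₀ : ℝ} (hM : a₂ * d₁ ^ 2 ≤ 2 * M₂) (ha₂ : η * Δ / 2 ≤ a₂) (hd₁ : κ * Δ / 2 ≤ d₁)
    (hη : 0 ≤ η) (hκ : 0 ≤ κ) (hΔ : 0 ≤ Δ) (hr₀ : r₀ ≤ η * κ ^ 2 / 32) :
    r₀ * Δ ^ 3 - 2 ≤ (M₂ - 4) / 2 := by
  have hd₁0 : 0 ≤ d₁ := le_trans (by positivity) hd₁
  have ha₂0 : 0 ≤ a₂ := le_trans (by positivity) ha₂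
  have h1 : (κ * Δ / 2) ^ 2 ≤ d₁ ^ 2 := pow_le_pow_left₀ (by positivity) hd₁ 2
  have h2 : η * Δ / 2 * (κ * Δ / 2) ^ 2 ≤ a₂ * d₁ ^ 2 :=
    mul_le_mul ha₂ h1 (by positivity) ha₂0
  have h3 : η * Δ / 2 * (κ * Δ / 2) ^ 2 = η * κ ^ 2 * Δ ^ 3 / 8 := by ring
  have h4 : r₀ * Δ ^ 3 ≤ η * κ ^ 2 / 32 * Δ ^ 3 := mul_le_mul_of_nonneg_right hr₀ (by positivity)
  nlinarith

end HighSatellite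

end Summit.Schanuel.Schanuel.Cruxes.ApproximationProperty.OrbitInterpolationDeterminant

end
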